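import Summits.CriticalPhenomena.PercolationContinuityZ3.Theorems.PercNearOneGluingNoHeavyLowerTailMajorityGluingQCertSym3TypeZ
import HarnessLib

/-!
# Spec-only degree-3 orbit certificates, II: the type-space digest `digestZ` and the gluing theorems (lane prim-rate, constants-miner 1, gen 38)

Support file for the closed crux `NoHeavyLowerTail` (stmt-CriticalPhenomena-4575), majority-gluing line.  Continues `…QCertSym3TypeZ` (spec rows `RowZ`, spec squares `SqZ`
with forms `FormZ`, spec parts `SymCert3Z` and their translation `toS`, `wf3S_toS`, the square expansion `evalC_sqC3S_expand` and the three form-pair lemmas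
`evalC_prod_cv/vc/vv`).  Here: `pairY` (type-space contributions of `zz·f·g·x_t` in its four shapes) and `evalC_pairY`; `sqY`/`evalC_sqY`; **`contribsZ`** and
**`evalC_contribsZ : z.wfZ → evalC val z.contribsZ = evalC val z.toS.contribs3S`**; `digestZ`; and the gluing layer for `SymCert3.concat b (parts.map toS)`:
`toS_bases`, `toS_wf`, `pos_of_digestsZ` (one level), `pos_of_superdigestsZ` (two levels), `checkW3S_concatZ` — consumed by `SymCert3.cut_of_posS3_count` exactly as the
parts of `…QCertSym3TypeParts`.  Kernel smoke tests: `sym3SmokeZ_spec`, `zSmoke3_spec` (a part with rows and squares of all four shapes at `m = 3`: `digestZ` = the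
enumerated digest of the translation).  No sorries.
-/

namespace Summit.CriticalPhenomena.PercolationContinuityZ3.Theorems

namespace HubOnly
namespace QCert

noncomputable section

namespace SymCert3Z

variable (z : SymCert3Z)

/-- **Type-space contributions of the form-pair product `zz·f·g·x_t`** (four shapes). -/
def pairY (f g : FormZ) (t : ℕ) (zz : ℤ) : List (ℕ × ℤ) :=
  if f.kd = 0 then
    (if g.kd = 0 then z.toS.prodY f.p f.q g.p g.q t zz
     else z.toS.keyTab false (g.p == z.base.D) (t == z.base.D) zz (tabF z.toS.Bs f.p f.q g.p t SymCert3.fuelY z.base.m))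
  else
    (if g.kd = 0 then z.toS.keyTab (f.p == z.base.D) false (t == z.base.D) zz (tabG z.toS.Bs g.p g.q f.p t SymCert3.fuelY z.base.m)
     else [(keyOfCode z.base.m z.toS.Bs (f.p == z.base.D) (g.p == z.base.D) (t == z.base.D) (cvcode z.toS.Bs z.base.m f.p g.p t), zz)])

/-- **Soundness of `pairY`**: the enumerated product of the two masks evaluates like the type-space list. -/
theorem evalC_pairY (val : ℕ → ℝ) (f g : FormZ) (t : ℕ) (zz : ℤ) (hf : f.ok z.base.m = true) (hg : g.ok z.base.m = true) (ht : t < z.base.NV) :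
    evalC val (z.toS.prodC3S (f.mask z.base.m) (g.mask z.base.m) t zz) = evalC val (z.pairY f g t zz) := by
  have hNV : z.toS.NV = z.base.NV := rfl
  have hm : z.toS.base.m = z.base.m := rfl
  unfold FormZ.ok at hf hg
  unfold pairY FormZ.mask
  by_cases hf0 : f.kd = 0 <;> by_cases hg0 : g.kd = 0 <;>
    simp only [hf0, hg0, if_true, if_false, Bool.and_eq_true, decide_eq_true_eq] at hf hg ⊢
  · exact z.toS.evalC_prodY val f.p f.q g.p g.q _ _ t zz hf.2 hg.2 (maskOK_cylMask _ _ _) (maskOK_cylMask _ _ _) (hNV ▸ ht)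
  · exact z.toS.evalC_prod_cv val f.p f.q g.p t zz hf.2 (hNV ▸ hg) (hNV ▸ ht)
  · exact z.toS.evalC_prod_vc val f.p g.p g.q t zz (hNV ▸ hf) hg.2 (hNV ▸ ht)
  · exact z.toS.evalC_prod_vv val f.p g.p t zz (hNV ▸ hf) (hNV ▸ hg) (hNV ▸ ht)

/-- **Type-space contributions of a spec square** `n·(a f₁ − b f₂)²·x_t` (RHS, negated): the four form-pair products. -/
def sqY (s : SqZ) : List (ℕ × ℤ) :=
  z.pairY s.f1 s.f1 s.t (-((s.n : ℤ) * s.a * s.a)) ++ z.pairY s.f1 s.f2 s.t ((s.n : ℤ) * s.a * s.b) ++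
    z.pairY s.f2 s.f1 s.t ((s.n : ℤ) * s.a * s.b) ++ z.pairY s.f2 s.f2 s.t (-((s.n : ℤ) * s.b * s.b))

/-- **Soundness of `sqY`.** -/
theorem evalC_sqY (val : ℕ → ℝ) (s : SqZ) (h1 : s.f1.ok z.base.m = true) (h2 : s.f2.ok z.base.m = true) (ht : s.t < z.base.NV) :
    evalC val (z.toS.sqC3S (s.toE z.base.m)) = evalC val (z.sqY s) := by
  rw [z.toS.evalC_sqC3S_expand]
  unfold sqY
  rw [evalC_append, evalC_append, evalC_append, evalC_append, evalC_append, evalC_append]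
  exact congrArg₂ (· + ·) (congrArg₂ (· + ·) (congrArg₂ (· + ·) (z.evalC_pairY val _ _ _ _ h1 h1 ht) (z.evalC_pairY val _ _ _ _ h1 h2 ht))
    (z.evalC_pairY val _ _ _ _ h2 h1 ht)) (z.evalC_pairY val _ _ _ _ h2 h2 ht)

/-- **ALL CONTRIBUTIONS OF A SPEC PART, IN TYPE SPACE.** -/
def contribsZ : List (ℕ × ℤ) :=
  (z.ell2.map z.toS.ell2Y).flatten ++ (z.lin.map z.toS.linY).flatten ++
    (z.rows.map fun ch => (ch.map fun r => z.toS.rowY (r.toE z.base.m)).flatten).flatten ++ (z.sqs.map fun ch => (ch.map z.sqY).flatten).flatten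

/-- **SOUNDNESS**: the type-space list evaluates like the enumerated contribution list of the translation. -/
theorem evalC_contribsZ (hw : z.wfZ = true) (val : ℕ → ℝ) : evalC val z.contribsZ = evalC val z.toS.contribs3S := by
  obtain ⟨he, hl, hr, hs⟩ := z.wfZ_entries hw
  have hNV : z.toS.NV = z.base.NV := rfl
  unfold contribsZ SymCert3.contribs3S
  rw [evalC_append, evalC_append, evalC_append, evalC_append, evalC_append, evalC_append]
  have e1 : evalC val (z.ell2.map z.toS.ell2Y).flatten = evalC val (z.toS.ell2.map z.toS.ell2C).flatten :=
    SymCert3.evalC_flatten_congr val _ _ _ fun e hm => (z.toS.evalC_ell2Y val e (he e hm).1 (he e hm).2).symm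
  have e2 : evalC val (z.lin.map z.toS.linY).flatten = evalC val (z.toS.lin.map z.toS.linC3).flatten :=
    SymCert3.evalC_flatten_congr val _ _ _ fun e hm => (z.toS.evalC_linY val e (hl e hm).1 (hl e hm).2.1 (hl e hm).2.2).symm
  have e3 : evalC val (z.rows.map fun ch => (ch.map fun r => z.toS.rowY (r.toE z.base.m)).flatten).flatten =
      evalC val (z.toS.rows.map fun ch => (ch.map z.toS.rowC3S).flatten).flatten := by
    rw [show z.toS.rows = z.rows.map fun ch => ch.map (RowZ.toE z.base.m) from rfl, List.map_map]
    refine SymCert3.evalC_flatten_congr val _ _ _ fun ch hch => ?_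
    simp only [Function.comp, List.map_map]
    refine SymCert3.evalC_flatten_congr val _ _ _ fun r hr' => ?_
    obtain ⟨hA, hX, hB, hY, ht⟩ := hr ch hch r hr'
    exact (z.toS.evalC_rowY val (r.toE z.base.m) (rowOK_toE z.base r hA hX hB hY) (hNV ▸ ht)).symm
  have e4 : evalC val (z.sqs.map fun ch => (ch.map z.sqY).flatten).flatten =
      evalC val (z.toS.sqs.map fun ch => (ch.map z.toS.sqC3S).flatten).flatten := by
    rw [show z.toS.sqs = z.sqs.map fun ch => ch.map (SqZ.toE z.base.m) from rfl, List.map_map]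
    refine SymCert3.evalC_flatten_congr val _ _ _ fun ch hch => ?_
    simp only [Function.comp, List.map_map]
    refine SymCert3.evalC_flatten_congr val _ _ _ fun s hs' => ?_
    obtain ⟨h1, h2, ht⟩ := hs ch hch s hs'
    exact (z.evalC_sqY val s h1 h2 ht).symm
  rw [e1, e2, e3, e4]

/-- **The type-space digest of a spec part.** -/
def digestZ (fuel : ℕ) : List (ℕ × ℤ) := aggr (msort2 fuel z.contribsZ)

/-- The digest evaluates like the enumerated contribution list of the translation. -/
theorem evalC_digestZ (hw : z.wfZ = true) (fuel : ℕ) (val : ℕ → ℝ) : evalC val (z.digestZ fuel) = evalC val z.toS.contribs3S := by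
  unfold digestZ
  rw [evalC_aggr, evalC_perm val (msort2_perm fuel _), z.evalC_contribsZ hw]

/-! ### Gluing translated parts -/

/-- The translations of parts on a common base have that base. -/
theorem toS_bases (b : Cert) (l : List SymCert3Z) (hb : ∀ d ∈ l, d.base = b) : ∀ d ∈ l.map toS, d.base = b := by
  intro d hd
  obtain ⟨d₀, hd₀, rfl⟩ := List.mem_map.1 hd
  exact hb d₀ hd₀

/-- The translations of checked parts pass the entry-wise check. -/
theorem toS_wf (l : List SymCert3Z) (hw : ∀ d ∈ l, d.wfZ = true) : ∀ d ∈ l.map toS, d.wf3S = true := by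
  intro d hd
  obtain ⟨d₀, hd₀, rfl⟩ := List.mem_map.1 hd
  exact d₀.wf3S_toS (hw d₀ hd₀)

/-- The parts' enumerated values are their type-space digests' values. -/
theorem map_evalC_of_digestsZ (fuel : ℕ) (val : ℕ → ℝ) {l : List SymCert3Z} {D : List (List (ℕ × ℤ))}
    (hw : ∀ d ∈ l, d.wfZ = true) (hD : List.Forall₂ (fun d dg => d.digestZ fuel = dg) l D) :
    ((l.map toS).map fun d => evalC val d.contribs3S) = D.map (evalC val) := by
  induction hD with
  | nil => rfl
  | @cons d dg l' D' hdg _ ih =>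
    rw [List.map_cons, List.map_cons, List.map_cons, ih fun d' hd' => hw d' (List.mem_cons_of_mem _ hd'), ← hdg, evalC_digestZ d (hw d (by simp))]

/-- **NONNEGATIVITY OF A GLUED CERTIFICATE FROM THE SPEC PARTS' TYPE-SPACE DIGESTS.** -/
theorem pos_of_digestsZ (b : Cert) (l : List SymCert3Z) (hb : ∀ d ∈ l, d.base = b) (hw : ∀ d ∈ l, d.wfZ = true) (fuel : ℕ)
    (D : List (List (ℕ × ℤ))) (hD : List.Forall₂ (fun d dg => d.digestZ fuel = dg) l D) (hruns : runsOK (msort2 fuel D.flatten) = true)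
    (val : ℕ → ℝ) (hval : ∀ key, 0 ≤ val key) : 0 ≤ evalC val (SymCert3.concat b (l.map toS)).contribs3S := by
  rw [SymCert3.evalC_concat3 b val (l.map toS) (toS_bases b l hb), map_evalC_of_digestsZ fuel val hw hD, ← evalC_flatten]
  exact evalC_nonneg_of_runsOK_msort2 val hval fuel _ hruns

/-- **Two levels** (groups' super-digests, as in `…QCertSym3Glue`). -/
theorem pos_of_superdigestsZ (b : Cert) (l : List SymCert3Z) (hb : ∀ d ∈ l, d.base = b) (hw : ∀ d ∈ l, d.wfZ = true) (fuel : ℕ)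
    (D : List (List (ℕ × ℤ))) (hD : List.Forall₂ (fun d dg => d.digestZ fuel = dg) l D) (G : List (List (List (ℕ × ℤ)))) (hG : G.flatten = D)
    (E : List (List (ℕ × ℤ))) (hE : List.Forall₂ (fun g e => aggr (msort2 fuel g.flatten) = e) G E)
    (hruns : runsOK (msort2 fuel E.flatten) = true) (val : ℕ → ℝ) (hval : ∀ key, 0 ≤ val key) :
    0 ≤ evalC val (SymCert3.concat b (l.map toS)).contribs3S := by
  rw [SymCert3.evalC_concat3 b val (l.map toS) (toS_bases b l hb), map_evalC_of_digestsZ fuel val hw hD, ← evalC_flatten, ← hG,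
    SymCert3.evalC_flatten_flatten, SymCert3.map_evalC_of_superdigests fuel val hE, ← evalC_flatten]
  exact evalC_nonneg_of_runsOK_msort2 val hval fuel _ hruns

/-- **The structural check of a glued translation** from the parts' cheap checks, the base conditions and the `δ²`-weight. -/
theorem checkW3S_concatZ (b : Cert) (l : List SymCert3Z) (hb : ∀ d ∈ l, d.base = b) (hw : ∀ d ∈ l, d.wfZ = true)
    (hcD : 0 < b.cD) (hh : 1 ≤ b.h) (hDD : 0 < (SymCert3.concat b (l.map toS)).ell2DDS) : (SymCert3.concat b (l.map toS)).checkW3S = true :=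
  SymCert3.checkW3S_concat_of_wf b (l.map toS) (toS_bases b l hb) (toS_wf l hw) hcD hh hDD

end SymCert3Z

/-! ### Smoke tests (kernel) -/

/-- The `(2,1)` smoke certificate of `…QCertSym3` as a spec part. -/
def sym3SmokeZ : SymCert3Z := ⟨⟨2, 1, 2, 1, 1, [], [], []⟩, [(4, 4, 1)], [(0, 4, 4, 1), (1, 4, 4, 1)], [], []⟩

/-- Its translation is `sym3Smoke`, its cheap check passes, and its type-space digest is the enumerated digest. -/
theorem sym3SmokeZ_spec : sym3SmokeZ.toS = sym3Smoke ∧ sym3SmokeZ.wfZ = true ∧ sym3SmokeZ.digestZ 8 = sym3Smoke.digest3 8 := by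
  refine ⟨rfl, by decide +kernel, by decide +kernel⟩

/-- A spec part with one row and one square of each form shape at `m = 3` (`D = 8`): its type-space digest equals the enumerated digest of its
translation, and the translation passes `wf3S` (kernel evaluation of the computed masks, small `m`). -/
def zSmoke3 : SymCert3Z :=
  ⟨⟨3, 2, 3, 2, 1, [], [], []⟩, [(8, 8, 1), (1, 8, 2)], [(0, 8, 8, 1), (2, 3, 8, 1)], [[⟨1, 2, 0, 6, 5, 8⟩, ⟨0, 1, 4, 1, 2, 3⟩]],
    [[⟨2, 3, 1, ⟨0, 1, 2⟩, ⟨0, 0, 6⟩, 8⟩, ⟨1, 1, 2, ⟨1, 5, 0⟩, ⟨0, 2, 1⟩, 1⟩, ⟨3, 2, 1, ⟨0, 4, 3⟩, ⟨1, 8, 0⟩, 3⟩, ⟨1, 2, 1, ⟨1, 8, 0⟩, ⟨1, 6, 0⟩, 8⟩]]⟩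

/-- The smoke digests agree and the translation is well formed. -/
theorem zSmoke3_spec : zSmoke3.wfZ = true ∧ zSmoke3.toS.wf3S = true ∧ zSmoke3.digestZ 12 = zSmoke3.toS.digest3 12 := by
  refine ⟨by decide +kernel, by decide +kernel, by decide +kernel⟩

end

end QCert
end HubOnly

end Summit.CriticalPhenomena.PercolationContinuityZ3.Theorems
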